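import Summits.QuantumFields.YangMills.Theorems.PoincareLipschitzSphereMapOneStepHC
import Summits.QuantumFields.YangMills.Theorems.PoincareLipschitzSphereMapSmallEnergyMollifiedLogFree

/-!
# Line «poincare_lipschitz» on crux `HistoryTailL` (stmt-QuantumFields-19936), route crux `BlockLipschitzL` (stmt-QuantumFields-23533), K2 organ of record LOC-REG-MIN —
# FLAT SHADOW «ENERGY → RANGE» (E→R) FOR LATTICE MINIMISERS INTO A SPHERE, FILE 5d-F4′: THE LOG-FREE ONE-STEP SOCKET —
# LEAD ★w1-19936 g9's displayed `hC` text WITH THE FACTOR `(1 + Real.log r)⁶` DELETED (threshold `E_r ≤ ε₁·r`, scale-invariant), same `A = 64·10¹⁴` uniform before `ε`,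
# same `ε₁ = min(ε,1)⁸·10⁻⁶¹`; regime (a) now runs on px7 g5's LOG-FREE good shell through ✓`oneStep_mollified_logfree`, regime (b) is unchanged (✓`oneStep_regimeB`)

Cell `ym3-torus` (YM ladder rung R3 = continuum SU(2) Yang–Mills on the three-torus — a RUNG, NOT the Clay problem: not d = 4, not infinite volume, not a mass gap); width seat
`ym-ust-19936-w5` gen 12 (LEAD ym-ust-19936-w1 g9 RULING g9-6 (ii) `hLogFreeDecay` «log-FREE small-energy one-step decay»; 06:49:23Z «★w5 first refusal on the re-assembly»;
px7 g5 ✓p705661 `exists_goodRadius_dyadic_logfree`).  THEOREMS ONLY (def-free); `--supports stmt-QuantumFields-19936`.  The log-free text implies the displayed `hC` a fortiori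
(`(1+log r)⁶ ≥ 1`).  Nothing here proves `hImproveCore`, `hImprove`, K-2∕K-4, `hRegH`, LOC-REG-MIN, a stub, `BlockLipschitzL`, `HistoryTailL` or a summit statement.
* §1 pure-real letters of the log-free regime (a) (`regimeA_T3_logfree`, `regimeA_TU_logfree`); §2 ★`oneStep_regimeA_logfree`;
* §3 ★★★`oneStep_logFree` (any finite-dimensional `V`) and ★★★`hLogFreeOneStep_holds` (`V = EuclideanSpace ℝ (Fin 4)`, the `hC` text with `* (1 + Real.log r) ^ 6` removed).
[folklore] ([SchoenUhlenbeck1982] §4 small-energy regularity, one-step improvement; lattice statements and constants are this file's).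
-/

set_option autoImplicit false

noncomputable section

open scoped BigOperators InnerProductSpace
open Finset

namespace Summit.QuantumFields.YangMills.Theorems.PoincareLipschitzSphereMapOneStepLogFree

open Literature.MathematicalPhysics.QuantumFieldTheory.Balaban1983to89
open B4Eq19LatticeOperators
open Summit.QuantumFields.YangMills.Theorems.PoincareLipschitzSphereMapSmallEnergyUnmollified (sum_box_le_sum_box)
open Summit.QuantumFields.YangMills.Theorems.PoincareLipschitzSphereMapSmallEnergyMollifiedLogFree (oneStep_mollified_logfree)
open Summit.QuantumFields.YangMills.Theorems.PoincareLipschitzSphereMapOneStepHC (regimeA_T1 regimeA_T2 regimeA_decay oneStep_regimeB regimeB_small)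

variable {V : Type*} [NormedAddCommGroup V] [InnerProductSpace ℝ V]

/-! ## §1 Pure-real letters of the log-free regime (a) -/

/-- The band term, log-free: `2√(6·(16E∕m)) ≤ ε∕200` with `m ≥ r∕2`, `E ≤ ε⁸10⁻⁶¹r`, `0 < ε ≤ 1`. [folklore] -/
theorem regimeA_T3_logfree {r ε E m : ℝ} (hr : 0 < r) (hε : 0 < ε) (hε1 : ε ≤ 1) (hE : 0 ≤ E) (hm : r / 2 ≤ m)
    (hthr : E ≤ ε ^ 8 / (10 : ℝ) ^ 61 * r) :
    2 * Real.sqrt (6 * (16 * E / m)) ≤ ε / 200 := by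
  have hm0 : 0 < m := by linarith
  have h1 : 6 * (16 * E / m) ≤ (ε / 400) ^ 2 := by
    rw [show 6 * (16 * E / m) = 96 * E / m by ring, div_le_iff₀ hm0]
    have hε8 : ε ^ 8 ≤ ε ^ 2 := pow_le_pow_of_le_one hε.le hε1 (by norm_num)
    nlinarith [mul_nonneg hr.le (sub_nonneg.2 hε8), pow_nonneg hε.le 8]
  have := (Real.sqrt_le_left (by positivity : 0 ≤ ε / 400)).mpr h1
  linarith

/-- The transition-band terms, log-free: `X = 8P·(16E∕m)`, `P ≤ ε²r∕10¹⁸`, `m ≥ r∕2` ⇒ `10¹¹·X + 8·10⁵·√(E·X) ≤ (ε∕4)·E`. [folklore] -/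
theorem regimeA_TU_logfree {r ε E m P : ℝ} (hr : 0 < r) (hε : 0 < ε) (hε1 : ε ≤ 1) (hE : 0 ≤ E) (hm : r / 2 ≤ m)
    (hP : P ≤ ε ^ 2 * r / (10 : ℝ) ^ 18) :
    (10 : ℝ) ^ 11 * (8 * P * (16 * E / m)) + 8 * (10 : ℝ) ^ 5 * Real.sqrt (E * (8 * P * (16 * E / m))) ≤ ε / 4 * E := by
  have hm0 : 0 < m := by linarith
  have hX : 8 * P * (16 * E / m) ≤ 256 / (10 : ℝ) ^ 18 * ε ^ 2 * E := by
    rw [show 8 * P * (16 * E / m) = 128 * P * E / m by ring, div_le_iff₀ hm0]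
    have h1 : P * E ≤ ε ^ 2 * r / (10 : ℝ) ^ 18 * E := mul_le_mul_of_nonneg_right hP hE
    have h2 : ε ^ 2 * r / (10 : ℝ) ^ 18 * E ≤ 2 / (10 : ℝ) ^ 18 * ε ^ 2 * E * m := by
      rw [show ε ^ 2 * r / (10 : ℝ) ^ 18 * E = 1 / (10 : ℝ) ^ 18 * ε ^ 2 * E * r by ring]
      have : 0 ≤ 1 / (10 : ℝ) ^ 18 * ε ^ 2 * E := by positivity
      nlinarith
    linarith [h1, h2]
  have hsq : Real.sqrt (E * (8 * P * (16 * E / m))) ≤ 2 * ε * E / (10 : ℝ) ^ 8 := by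
    refine (Real.sqrt_le_left (by positivity)).mpr ?_
    calc E * (8 * P * (16 * E / m)) ≤ E * (256 / (10 : ℝ) ^ 18 * ε ^ 2 * E) := mul_le_mul_of_nonneg_left hX hE
      _ ≤ (2 * ε * E / (10 : ℝ) ^ 8) ^ 2 := by rw [div_pow, le_div_iff₀ (by positivity)]; nlinarith [sq_nonneg (ε * E)]
  have hε2 : ε ^ 2 ≤ ε := by nlinarith
  have hεE : 0 ≤ ε * E := by positivity
  have h1 : (10 : ℝ) ^ 11 * (8 * P * (16 * E / m)) ≤ ε / 8 * E := by
    calc (10 : ℝ) ^ 11 * (8 * P * (16 * E / m)) ≤ (10 : ℝ) ^ 11 * (256 / (10 : ℝ) ^ 18 * ε ^ 2 * E) :=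
          mul_le_mul_of_nonneg_left hX (by positivity)
      _ ≤ ε / 8 * E := by nlinarith [mul_le_mul_of_nonneg_right hε2 hE]
  have h2 : 8 * (10 : ℝ) ^ 5 * Real.sqrt (E * (8 * P * (16 * E / m))) ≤ ε / 8 * E := by
    calc 8 * (10 : ℝ) ^ 5 * Real.sqrt (E * (8 * P * (16 * E / m))) ≤ 8 * (10 : ℝ) ^ 5 * (2 * ε * E / (10 : ℝ) ^ 8) :=
          mul_le_mul_of_nonneg_left hsq (by positivity)
      _ ≤ ε / 8 * E := by rw [mul_div_assoc']; rw [div_le_iff₀ (by positivity)]; nlinarith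
  linarith

/-! ## §2 The log-free regime (a) -/

/-- ★ **REGIME (a), LOG-FREE**: `1 ≤ ρ`, `4(ρ+1) < r`, `0 < ε ≤ 1`, `10¹⁸ ≤ ε²r`, `E_r ≤ ε⁸10⁻⁶¹·r` ⇒ `E_ρ ≤ (64·10¹⁴((ρ+1)∕r)³ + ε∕2)·E_r + 2·sl`
(✓`oneStep_mollified_logfree` at `p = r − r∕2 − 2^{n+4}`, `q = r − 2^{n+4}`, `2^n ≤ ε²r∕10¹⁸ < 2^{n+1}`, `η = ε∕64`). [folklore] [cite: SchoenUhlenbeck1982, §4] -/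
theorem oneStep_regimeA_logfree [FiniteDimensional ℝ V] (u : Zd 3 → V) (x : Zd 3) {r ρ : ℤ} (hρ : 1 ≤ ρ) (h4 : 4 * (ρ + 1) < r)
    (hu : ∀ y, ‖u y‖ = 1)
    {sl : ℝ} (hminU : ∀ w : Zd 3 → V, (∀ y, ‖w y‖ = 1) → (∀ y ∉ box x (r - 1), w y = u y) →
      ∑ y ∈ box x r, ∑ μ, ‖u (y + unitVec μ) - u y‖ ^ 2 ≤ ∑ y ∈ box x r, ∑ μ, ‖w (y + unitVec μ) - w y‖ ^ 2 + sl)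
    {ε : ℝ} (hε : 0 < ε) (hε1 : ε ≤ 1)
    (hreg : (10 : ℝ) ^ 18 ≤ ε ^ 2 * r)
    (hthr : (∑ y ∈ box x r, ∑ μ, ‖u (y + unitVec μ) - u y‖ ^ 2) ≤ ε ^ 8 / (10 : ℝ) ^ 61 * r) :
    ∑ y ∈ box x ρ, ∑ μ, ‖u (y + unitVec μ) - u y‖ ^ 2 ≤
      (64 * (10 : ℝ) ^ 14 * (((ρ : ℝ) + 1) / r) ^ 3 + ε / 2) * ∑ y ∈ box x r, ∑ μ, ‖u (y + unitVec μ) - u y‖ ^ 2 + 2 * sl := by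
  set E := ∑ y ∈ box x r, ∑ μ, ‖u (y + unitVec μ) - u y‖ ^ 2 with hE
  have hE0 : 0 ≤ E := Finset.sum_nonneg fun _ _ => Finset.sum_nonneg fun _ _ => sq_nonneg _
  have hr9 : 9 ≤ r := by omega
  have hr1 : (1 : ℝ) ≤ r := by exact_mod_cast (by omega : (1 : ℤ) ≤ r)
  have hr0 : (0 : ℝ) < r := by linarith
  -- the dyadic scale
  set Λ := ε ^ 2 * r / (10 : ℝ) ^ 18 with hΛdef
  have hΛ1 : 1 ≤ Λ := by rw [hΛdef, le_div_iff₀ (by positivity)]; linarith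
  obtain ⟨n, hn1, hn2⟩ := exists_nat_pow_near hΛ1 one_lt_two
  have hΛr : Λ ≤ r / (10 : ℝ) ^ 18 := by
    rw [hΛdef, div_le_div_iff₀ (by positivity) (by positivity)]
    have hε2 : ε ^ 2 ≤ 1 := pow_le_one₀ hε.le hε1
    have : ε ^ 2 * r ≤ r := by nlinarith
    nlinarith
  -- integer bookkeeping (`N = 2^{n+2}` is an atom for `omega`)
  have hNr : (10 : ℤ) ^ 18 * (2 : ℤ) ^ (n + 2) ≤ 4 * r := by
    have h : (10 : ℝ) ^ 18 * (2 : ℝ) ^ (n + 2) ≤ 4 * r := by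
      rw [pow_add]; have := hn1.trans hΛr; rw [le_div_iff₀ (by positivity)] at this; nlinarith
    exact_mod_cast h
  have h24 : (2 : ℤ) ^ (n + 4) = 4 * (2 : ℤ) ^ (n + 2) := by ring
  have hpq : r - r / 2 - (2 : ℤ) ^ (n + 4) ≤ r - (2 : ℤ) ^ (n + 4) := by omega
  have hqr : r - (2 : ℤ) ^ (n + 4) + (2 : ℤ) ^ (n + 4) ≤ r := by omega
  have hp : (2 : ℤ) ^ (n + 2) + 2 ≤ r - r / 2 - (2 : ℤ) ^ (n + 4) := by
    rw [h24]; generalize (2 : ℤ) ^ (n + 2) = N at hNr ⊢; omega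
  have hm : (r : ℝ) / 2 ≤ (((r - (2 : ℤ) ^ (n + 4) - (r - r / 2 - (2 : ℤ) ^ (n + 4)) + 1 : ℤ)) : ℝ) := by
    have : r ≤ 2 * (r - (2 : ℤ) ^ (n + 4) - (r - r / 2 - (2 : ℤ) ^ (n + 4)) + 1) := by omega
    have h' : (r : ℝ) ≤ 2 * (((r - (2 : ℤ) ^ (n + 4) - (r - r / 2 - (2 : ℤ) ^ (n + 4)) + 1 : ℤ)) : ℝ) := by exact_mod_cast this
    linarith
  -- the displayed smallness `η = ε/64` (T1∕T2 are ✓F4's letters at `L = 1`)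
  set a : ℝ := (2 : ℝ) ^ (n + 1) + 1 with ha
  have hΛa : ε ^ 2 * r / ((10 : ℝ) ^ 18 * (1 : ℝ) ^ 2) < a := by rw [one_pow, mul_one, ha]; linarith
  have hthr1 : E * (1 : ℝ) ^ 6 ≤ ε ^ 8 / (10 : ℝ) ^ 61 * r := by rw [one_pow, mul_one]; exact hthr
  have hT1 := regimeA_T1 (E := E) hr0 le_rfl hε hΛa hthr1
  have hT2 := regimeA_T2 (E := E) hr0 le_rfl hε hε1 hE0 hΛa hthr1
  have hT3 := regimeA_T3_logfree (E := E) hr0 hε hε1 hE0 hm hthr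
  have hTU := regimeA_TU_logfree (E := E) hr0 hε hε1 hE0 hm hn1
  obtain ⟨R, hR1, hR2, hstep⟩ := oneStep_mollified_logfree u x (r := r) (p := r - r / 2 - (2 : ℤ) ^ (n + 4)) (q := r - (2 : ℤ) ^ (n + 4)) (n := n)
    hpq hqr hp hu hminU (η := ε / 64) (by linarith [hT1, hT2, hT3]) (by linarith)
  have hρR : ρ ≤ R - 2 := by
    rw [h24] at hR1; generalize (2 : ℤ) ^ (n + 2) = N at hNr hR1 ⊢; omega
  have hR4 : r ≤ 4 * (R - 1) := by
    rw [h24] at hR1; generalize (2 : ℤ) ^ (n + 2) = N at hNr hR1 ⊢; omega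
  have h := hstep ρ (by omega) hρR
  have hR4' : (r : ℝ) ≤ 4 * ((R : ℝ) - 1) := by exact_mod_cast hR4
  have hρ0 : (0 : ℝ) ≤ (ρ : ℝ) + 1 := by
    have : (1 : ℝ) ≤ ρ := by exact_mod_cast hρ
    linarith
  have hdec := mul_le_mul_of_nonneg_right (regimeA_decay hr0 hR4' hρ0) hE0
  rw [show (2 : ℝ) ^ (n + 3) = 8 * (2 : ℝ) ^ n by ring] at h
  have hε8 : 8 * (ε / 64) * E = ε / 8 * E := by ring
  rw [hε8] at h
  linarith [h, hdec, hTU, mul_nonneg hε.le hE0]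

/-! ## §3 The log-free socket -/

/-- ★★★ **THE LOG-FREE ONE-STEP SOCKET** (any finite-dimensional `V`): LEAD's `hC` text with the factor `(1 + Real.log r)⁶` DELETED — threshold `E_r ≤ ε₁·r`
(scale-invariant small energy), `A = 64·10¹⁴` uniform before `ε`, `ε₁ = min(ε,1)⁸·10⁻⁶¹`.  Pairs `4(ρ+1) ≥ r` trivial; regime (a) ✓`oneStep_regimeA_logfree` when `10¹⁸ ≤ ε'²r`,
else `r²E_r ≤ ε'²10⁻⁷` (✓`regimeB_small` at `L = 1`) and ✓`oneStep_regimeB`. [folklore] [cite: SchoenUhlenbeck1982, §4] -/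
theorem oneStep_logFree [FiniteDimensional ℝ V] :
    ∃ A : ℝ, 0 ≤ A ∧ ∀ ε : ℝ, 0 < ε → ∃ ε₁ : ℝ, 0 < ε₁ ∧
      ∀ (u : Zd 3 → V) (x : Zd 3) (r : ℤ) (sl : ℝ), 0 ≤ sl →
        (∀ y, ‖u y‖ = 1) →
        (∀ w : Zd 3 → V, (∀ y, ‖w y‖ = 1) → (∀ y, y ∉ box x (r - 1) → w y = u y) →
          ∑ y ∈ box x r, ∑ μ : Fin 3, ‖u (y + unitVec μ) - u y‖ ^ 2 ≤
            (∑ y ∈ box x r, ∑ μ : Fin 3, ‖w (y + unitVec μ) - w y‖ ^ 2) + sl) →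
        (∑ y ∈ box x r, ∑ μ : Fin 3, ‖u (y + unitVec μ) - u y‖ ^ 2) ≤ ε₁ * r →
        ∀ ρ : ℤ, 1 ≤ ρ → ρ + 1 ≤ r →
          ∑ y ∈ box x ρ, ∑ μ : Fin 3, ‖u (y + unitVec μ) - u y‖ ^ 2 ≤
            (A * (((ρ : ℝ) + 1) / r) ^ 3 + ε) * (∑ y ∈ box x r, ∑ μ : Fin 3, ‖u (y + unitVec μ) - u y‖ ^ 2) + 2 * sl := by
  refine ⟨64 * (10 : ℝ) ^ 14, by norm_num, fun ε hε => ?_⟩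
  set ε' := min ε 1 with hε'
  have hε'0 : 0 < ε' := lt_min hε one_pos
  have hε'1 : ε' ≤ 1 := min_le_right _ _
  have hε'ε : ε' ≤ ε := min_le_left _ _
  refine ⟨ε' ^ 8 / (10 : ℝ) ^ 61, by positivity, fun u x r sl hsl hu hmin hthr ρ hρ hρr => ?_⟩
  set E := ∑ y ∈ box x r, ∑ μ : Fin 3, ‖u (y + unitVec μ) - u y‖ ^ 2 with hE
  have hE0 : 0 ≤ E := Finset.sum_nonneg fun _ _ => Finset.sum_nonneg fun _ _ => sq_nonneg _
  have hEρ : ∑ y ∈ box x ρ, ∑ μ : Fin 3, ‖u (y + unitVec μ) - u y‖ ^ 2 ≤ E := by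
    rw [hE]; exact sum_box_le_sum_box u x (by omega)
  have hr1 : (1 : ℝ) ≤ r := by exact_mod_cast (by omega : (1 : ℤ) ≤ r)
  have hr0 : (0 : ℝ) < r := by linarith
  have hf0 : 0 ≤ (((ρ : ℝ) + 1) / r) ^ 3 := by
    have : (0 : ℝ) ≤ (ρ : ℝ) + 1 := by
      have : (1 : ℝ) ≤ ρ := by exact_mod_cast hρ
      linarith
    positivity
  by_cases htriv : r ≤ 4 * (ρ + 1)
  · -- trivial pairs
    have hq : (1 / 4 : ℝ) ≤ ((ρ : ℝ) + 1) / r := by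
      rw [le_div_iff₀ hr0]
      have : (r : ℝ) ≤ 4 * ((ρ : ℝ) + 1) := by exact_mod_cast htriv
      linarith
    have hq3 : (1 / 4 : ℝ) ^ 3 ≤ (((ρ : ℝ) + 1) / r) ^ 3 := pow_le_pow_left₀ (by norm_num) hq 3
    have hAf : 1 ≤ 64 * (10 : ℝ) ^ 14 * (((ρ : ℝ) + 1) / r) ^ 3 := by nlinarith
    have h1 : E ≤ 64 * (10 : ℝ) ^ 14 * (((ρ : ℝ) + 1) / r) ^ 3 * E := le_mul_of_one_le_left hE0 hAf
    nlinarith [mul_nonneg hε.le hE0]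
  · push Not at htriv
    by_cases hreg : (10 : ℝ) ^ 18 ≤ ε' ^ 2 * r
    · have h := oneStep_regimeA_logfree u x hρ htriv hu hmin hε'0 hε'1 hreg hthr
      nlinarith [mul_le_mul_of_nonneg_right hε'ε hE0]
    · push Not at hreg
      have hsmall : (r : ℝ) ^ 2 * E ≤ ε' ^ 2 / 10 ^ 7 :=
        regimeB_small (L := 1) hr0 le_rfl hε'0 (by rw [one_pow, mul_one]; exact hreg) (by rw [one_pow, mul_one]; exact hthr)
      have h := oneStep_regimeB u x hρ htriv hu hmin hε'0 hε'1 hsmall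
      nlinarith [mul_le_mul_of_nonneg_right hε'ε hE0, mul_nonneg hf0 hE0]

/-- ★★★ **`hLogFreeOneStep_holds`** — `V = EuclideanSpace ℝ (Fin 4)`: LEAD ★w1-19936 g9's DISPLAYED `hC` (`hOneStepText`, 2e0c4712bb15d94d) with `* (1 + Real.log r) ^ 6`
removed from the threshold row; a candidate text for g9-6 (ii) `hLogFreeDecay` (the LEAD names the text; this is the deletion variant). [folklore] [cite: SchoenUhlenbeck1982, §4] -/
theorem hLogFreeOneStep_holds :
    ∃ A : ℝ, 0 ≤ A ∧ ∀ ε : ℝ, 0 < ε → ∃ ε₁ : ℝ, 0 < ε₁ ∧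
      ∀ (u : Zd 3 → EuclideanSpace ℝ (Fin 4)) (x : Zd 3) (r : ℤ) (sl : ℝ), 0 ≤ sl →
        (∀ y, ‖u y‖ = 1) →
        (∀ w : Zd 3 → EuclideanSpace ℝ (Fin 4), (∀ y, ‖w y‖ = 1) → (∀ y, y ∉ box x (r - 1) → w y = u y) →
          ∑ y ∈ box x r, ∑ μ : Fin 3, ‖u (y + unitVec μ) - u y‖ ^ 2 ≤
            (∑ y ∈ box x r, ∑ μ : Fin 3, ‖w (y + unitVec μ) - w y‖ ^ 2) + sl) →
        (∑ y ∈ box x r, ∑ μ : Fin 3, ‖u (y + unitVec μ) - u y‖ ^ 2) ≤ ε₁ * r →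
        ∀ ρ : ℤ, 1 ≤ ρ → ρ + 1 ≤ r →
          ∑ y ∈ box x ρ, ∑ μ : Fin 3, ‖u (y + unitVec μ) - u y‖ ^ 2 ≤
            (A * (((ρ : ℝ) + 1) / r) ^ 3 + ε) * (∑ y ∈ box x r, ∑ μ : Fin 3, ‖u (y + unitVec μ) - u y‖ ^ 2) + 2 * sl :=
  oneStep_logFree

end Summit.QuantumFields.YangMills.Theorems.PoincareLipschitzSphereMapOneStepLogFree
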